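import Literature.Analysis.FluidPDE.AxisymNoSwirlVorticity
import Literature.Analysis.FluidPDE.WholeSpaceIBP
import HarnessLib

/-!
# KNSS 2009, Theorem 5.2: continuity in time and integrability of the vorticity-equation integrand

Analysis/FluidPDE support file (all results proved) on the decomposition path of the named fact
`Literature.Analysis.FluidPDE.KNSS2009_liouville_axisymmetric_no_swirl` (Koch–Nadirashvili–
Seregin–Šverák, *Liouville theorems for the Navier–Stokes equations and applications*, Acta
Math. 203 (2009) = arXiv:0709.3599, **Theorem 5.2**). The §4 representative `U`, `b` of a
bounded weak solution (`KNSS2009_regularity_boundedWeak_ancient`, `KNSSRegularity`) comes with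
bounded spatial derivatives, derivatives of order `≥ 1` Lipschitz in time, `U` jointly
measurable, `b` measurable bounded, and the vorticity equation (4.5) in time-integrated form with
integrand `Δω − Dω[U + b] + DU[ω]`, `ω = curl U`. The scalar equation (5.10) in integrated form
(`integral_scalarEq_of_vorticityEq`, `AxisymNoSwirlScalarEq`) asks this integrand to be interval
integrable (hypothesis `hint`); this file proves that from the clauses of the fact:

* `norm_laplacian_le_three_mul`, `norm_iteratedFDeriv_curl_le`: `‖Δf(x)‖ ≤ 3‖D²f(x)‖` on `ℝ³`
  and `‖Dⁿ(curl w)(x)‖ ≤ ‖curlCLM‖ ‖Dⁿ⁺¹w(x)‖`;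
* `continuousOn_fderiv_slice`, `continuousOn_curl_slice`, `continuousOn_fderiv_curl_slice`,
  `continuousOn_laplacian_curl_slice`: `DU(t)(x)`, `ω(t, x)`, `Dω(t)(x)`, `Δω(t, x)` are
  continuous in `t < 0` (Lipschitz, from the clauses `k = 1, 1, 2, 3`);
* `intervalIntegrable_vorticity_integrand`: the integrand is bounded and measurable in `τ`
  (continuous ingredients, measurable drift `U(τ, x) + b(τ)`), hence interval integrable on
  `[s, t]`, `s ≤ t < 0`.

## References

* G. Koch, N. Nadirashvili, G. Seregin, V. Šverák, *Liouville theorems for the Navier–Stokes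
  equations and applications*, Acta Math. 203 (2009) 83–105 = arXiv:0709.3599: §4 (4.5)–(4.8)
  (p. 8) and the proof of Theorem 5.2 (p. 10). [KochNadirashviliSereginSverak2009]
-/

noncomputable section

open MeasureTheory Set Function Filter Topology
open scoped RealInnerProductSpace ContDiff Laplacian

namespace Literature.Analysis.FluidPDE

/-! ### Pointwise bounds: Laplacian and curl against iterated derivatives -/

/-- `‖Δ f (x)‖ ≤ 3 ‖D²f(x)‖` on `ℝ³` (the Laplacian is the trace of the Hessian over the
standard basis). [folklore] -/
theorem norm_laplacian_le_three_mul {F : Type*} [NormedAddCommGroup F] [NormedSpace ℝ F]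
    (f : EuclideanSpace ℝ (Fin 3) → F) (x : EuclideanSpace ℝ (Fin 3)) :
    ‖(Δ f) x‖ ≤ 3 * ‖iteratedFDeriv ℝ 2 f x‖ := by
  classical
  set b := EuclideanSpace.basisFun (Fin 3) ℝ with hb
  rw [InnerProductSpace.laplacian_eq_iteratedFDeriv_orthonormalBasis f b]
  have hbi : ∀ i, ‖b i‖ = 1 := fun i => b.orthonormal.1 i
  have hterm : ∀ i, ‖iteratedFDeriv ℝ 2 f x ![b i, b i]‖ ≤ ‖iteratedFDeriv ℝ 2 f x‖ := by
    intro i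
    calc ‖iteratedFDeriv ℝ 2 f x ![b i, b i]‖
        ≤ ‖iteratedFDeriv ℝ 2 f x‖ * ∏ j, ‖(![b i, b i] : Fin 2 → _) j‖ :=
          ContinuousMultilinearMap.le_opNorm _ _
      _ = ‖iteratedFDeriv ℝ 2 f x‖ := by simp [Fin.prod_univ_two, hbi]
  calc ‖∑ i, iteratedFDeriv ℝ 2 f x ![b i, b i]‖
      ≤ ∑ i, ‖iteratedFDeriv ℝ 2 f x ![b i, b i]‖ := norm_sum_le _ _
    _ ≤ ∑ _i : Fin 3, ‖iteratedFDeriv ℝ 2 f x‖ := Finset.sum_le_sum fun i _ => hterm i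
    _ = 3 * ‖iteratedFDeriv ℝ 2 f x‖ := by simp

/-- `‖Dⁿ(curl w)(x)‖ ≤ ‖curlCLM‖ ‖Dⁿ⁺¹ w (x)‖` for `w ∈ Cⁿ⁺¹` (`curl = curlCLM ∘ D`). [folklore] -/
theorem norm_iteratedFDeriv_curl_le {w : EuclideanSpace ℝ (Fin 3) → EuclideanSpace ℝ (Fin 3)}
    {n : ℕ} (hw : ContDiff ℝ (n + 1) w) (x : EuclideanSpace ℝ (Fin 3)) :
    ‖iteratedFDeriv ℝ n (curl w) x‖ ≤
      ‖(curlCLM : (EuclideanSpace ℝ (Fin 3) →L[ℝ] EuclideanSpace ℝ (Fin 3)) →L[ℝ]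
        EuclideanSpace ℝ (Fin 3))‖ * ‖iteratedFDeriv ℝ (n + 1) w x‖ := by
  rw [curl_eq_curlCLM_comp, ← norm_iteratedFDeriv_fderiv]
  have hD : ContDiff ℝ n (fderiv ℝ w) := hw.fderiv_right (m := n) (by norm_cast)
  exact ContinuousLinearMap.norm_iteratedFDeriv_comp_left _ hD.contDiffAt le_rfl

/-! ### Continuity in time from the Lipschitz clauses of §4 -/

/-- A function with `‖G t − G s‖ ≤ K |t − s|` for all `s, t < 0` is continuous on `(−∞, 0)`. [folklore] -/
theorem continuousOn_Iio_of_norm_sub_le {F : Type*} [NormedAddCommGroup F] {G : ℝ → F} {K : ℝ}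
    (h : ∀ s < 0, ∀ t < 0, ‖G t - G s‖ ≤ K * |t - s|) : ContinuousOn G (Iio 0) := by
  rw [Metric.continuousOn_iff]
  intro t ht ε hε
  refine ⟨ε / (|K| + 1), by positivity, fun s hs hst => ?_⟩
  rw [dist_eq_norm]
  rw [dist_eq_norm, Real.norm_eq_abs] at hst
  calc ‖G s - G t‖ ≤ K * |s - t| := h t ht s hs
    _ ≤ (|K| + 1) * |s - t| :=
        mul_le_mul_of_nonneg_right ((le_abs_self K).trans (by linarith)) (abs_nonneg _)
    _ < (|K| + 1) * (ε / (|K| + 1)) := mul_lt_mul_of_pos_left hst (by positivity)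
    _ = ε := by field_simp

section Family

variable {U : ℝ → EuclideanSpace ℝ (Fin 3) → EuclideanSpace ℝ (Fin 3)}

/-- The difference of two slices, as a field. [folklore] -/
private theorem sub_slice_eq (t s : ℝ) :
    (fun y => U t y - U s y) = U t - U s := rfl

/-- Lipschitz-in-time `k`-th derivatives control the `k`-th derivative of the difference of two
slices: `‖Dᵏ(U t − U s)(x)‖ ≤ L |t − s|`. [folklore] -/
theorem norm_iteratedFDeriv_sub_slice_le {k : ℕ} (hU : ∀ t < 0, ContDiff ℝ k (U t)) {L : ℝ}
    (hlip : ∀ s < 0, ∀ t < 0, ∀ x,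
      ‖iteratedFDeriv ℝ k (U t) x - iteratedFDeriv ℝ k (U s) x‖ ≤ L * |t - s|)
    {s t : ℝ} (hs : s < 0) (ht : t < 0) (x : EuclideanSpace ℝ (Fin 3)) :
    ‖iteratedFDeriv ℝ k (U t - U s) x‖ ≤ L * |t - s| := by
  rw [iteratedFDeriv_sub_apply (hU t ht).contDiffAt (hU s hs).contDiffAt]
  exact hlip s hs t ht x

/-- **The Jacobian is continuous in time** under clause `k = 1` of the §4 fact. [folklore] -/
theorem continuousOn_fderiv_slice (hU : ∀ t < 0, ContDiff ℝ 1 (U t)) {L : ℝ}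
    (hlip : ∀ s < 0, ∀ t < 0, ∀ x,
      ‖iteratedFDeriv ℝ 1 (U t) x - iteratedFDeriv ℝ 1 (U s) x‖ ≤ L * |t - s|)
    (x : EuclideanSpace ℝ (Fin 3)) : ContinuousOn (fun t => fderiv ℝ (U t) x) (Iio 0) := by
  refine continuousOn_Iio_of_norm_sub_le (K := L) fun s hs t ht => ?_
  have h := norm_iteratedFDeriv_sub_slice_le hU hlip hs ht x
  rwa [norm_iteratedFDeriv_one, ← sub_slice_eq,
    fderiv_fun_sub ((hU t ht).differentiable one_ne_zero x)
      ((hU s hs).differentiable one_ne_zero x)] at h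

/-- **The vorticity is continuous in time** under clause `k = 1` of the §4 fact. [folklore] -/
theorem continuousOn_curl_slice (hU : ∀ t < 0, ContDiff ℝ 1 (U t)) {L : ℝ}
    (hlip : ∀ s < 0, ∀ t < 0, ∀ x,
      ‖iteratedFDeriv ℝ 1 (U t) x - iteratedFDeriv ℝ 1 (U s) x‖ ≤ L * |t - s|)
    (x : EuclideanSpace ℝ (Fin 3)) : ContinuousOn (fun t => curl (U t) x) (Iio 0) := by
  have h := continuousOn_fderiv_slice hU hlip x
  simp_rw [curl_eq_curlCLM]
  exact curlCLM.continuous.comp_continuousOn h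

/-- The curls of two slices differ by the curl of the difference (as functions). [folklore] -/
theorem curl_sub_slice (hU : ∀ t < 0, ContDiff ℝ 1 (U t)) {s t : ℝ} (hs : s < 0) (ht : t < 0) :
    curl (U t) - curl (U s) = curl (U t - U s) := by
  funext x
  rw [Pi.sub_apply, ← sub_slice_eq, curl_sub ((hU t ht).differentiable one_ne_zero x)
    ((hU s hs).differentiable one_ne_zero x)]

/-- **The vorticity gradient is continuous in time** under clause `k = 2` of the §4 fact:
`‖D(curl U(t))(x) − D(curl U(s))(x)‖ ≤ ‖curlCLM‖ L |t − s|`. [folklore] -/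
theorem continuousOn_fderiv_curl_slice (hU : ∀ t < 0, ContDiff ℝ 2 (U t)) {L : ℝ}
    (hlip : ∀ s < 0, ∀ t < 0, ∀ x,
      ‖iteratedFDeriv ℝ 2 (U t) x - iteratedFDeriv ℝ 2 (U s) x‖ ≤ L * |t - s|)
    (x : EuclideanSpace ℝ (Fin 3)) : ContinuousOn (fun t => fderiv ℝ (curl (U t)) x) (Iio 0) := by
  set K := ‖(curlCLM : (EuclideanSpace ℝ (Fin 3) →L[ℝ] EuclideanSpace ℝ (Fin 3)) →L[ℝ]
    EuclideanSpace ℝ (Fin 3))‖ with hK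
  have hU1 : ∀ t < 0, ContDiff ℝ 1 (U t) := fun t ht => (hU t ht).of_le one_le_two
  have hcd : ∀ t < 0, Differentiable ℝ (curl (U t)) := fun t ht =>
    (contDiff_curl (n := 1) (hU t ht)).differentiable (by norm_num)
  refine continuousOn_Iio_of_norm_sub_le (K := K * L) fun s hs t ht => ?_
  have hW : ContDiff ℝ 2 (U t - U s) := (hU t ht).sub (hU s hs)
  calc ‖fderiv ℝ (curl (U t)) x - fderiv ℝ (curl (U s)) x‖
      = ‖iteratedFDeriv ℝ 1 (curl (U t - U s)) x‖ := by
        rw [norm_iteratedFDeriv_one, ← curl_sub_slice hU1 hs ht,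
          fderiv_sub (hcd t ht x) (hcd s hs x)]
    _ ≤ K * ‖iteratedFDeriv ℝ 2 (U t - U s) x‖ := norm_iteratedFDeriv_curl_le (n := 1) hW x
    _ ≤ K * (L * |t - s|) :=
        mul_le_mul_of_nonneg_left (norm_iteratedFDeriv_sub_slice_le hU hlip hs ht x) (by positivity)
    _ = K * L * |t - s| := by ring

/-- **The vorticity Laplacian is continuous in time** under clause `k = 3` of the §4 fact:
`‖Δ(curl U(t))(x) − Δ(curl U(s))(x)‖ ≤ 3 ‖curlCLM‖ L |t − s|`. [folklore] -/
theorem continuousOn_laplacian_curl_slice (hU : ∀ t < 0, ContDiff ℝ 3 (U t)) {L : ℝ}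
    (hlip : ∀ s < 0, ∀ t < 0, ∀ x,
      ‖iteratedFDeriv ℝ 3 (U t) x - iteratedFDeriv ℝ 3 (U s) x‖ ≤ L * |t - s|)
    (x : EuclideanSpace ℝ (Fin 3)) : ContinuousOn (fun t => (Δ (curl (U t))) x) (Iio 0) := by
  set K := ‖(curlCLM : (EuclideanSpace ℝ (Fin 3) →L[ℝ] EuclideanSpace ℝ (Fin 3)) →L[ℝ]
    EuclideanSpace ℝ (Fin 3))‖ with hK
  have hU1 : ∀ t < 0, ContDiff ℝ 1 (U t) := fun t ht => (hU t ht).of_le (by norm_num)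
  have hc2 : ∀ t < 0, ContDiff ℝ 2 (curl (U t)) := fun t ht => contDiff_curl (n := 2) (hU t ht)
  refine continuousOn_Iio_of_norm_sub_le (K := 3 * K * L) fun s hs t ht => ?_
  have hW : ContDiff ℝ 3 (U t - U s) := (hU t ht).sub (hU s hs)
  calc ‖(Δ (curl (U t))) x - (Δ (curl (U s))) x‖
      = ‖(Δ (curl (U t - U s))) x‖ := by
        rw [← (hc2 t ht).contDiffAt.laplacian_sub (hc2 s hs).contDiffAt, curl_sub_slice hU1 hs ht]
    _ ≤ 3 * ‖iteratedFDeriv ℝ 2 (curl (U t - U s)) x‖ := norm_laplacian_le_three_mul _ x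
    _ ≤ 3 * (K * ‖iteratedFDeriv ℝ 3 (U t - U s) x‖) :=
        mul_le_mul_of_nonneg_left (norm_iteratedFDeriv_curl_le (n := 2) hW x) (by norm_num)
    _ ≤ 3 * (K * (L * |t - s|)) := by
        gcongr
        exact norm_iteratedFDeriv_sub_slice_le hU hlip hs ht x
    _ = 3 * K * L * |t - s| := by ring

end Family

/-! ### Integrability of the integrand of the vorticity equation (4.5) -/

/-- **The integrand of the time-integrated vorticity equation is integrable on every compact
subinterval of `(−∞, 0)`.** For the representative `U`, `b` of §4
(`KNSS2009_regularity_boundedWeak_ancient`: `C^∞` slices — `C⁴` suffices —, jointly measurable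
`U`, measurable bounded `b`, bounded derivatives, derivatives of order `≥ 1` Lipschitz in time),
the function `τ ↦ Δω(τ, x) − Dω(τ, x)[U(τ, x) + b(τ)] + DU(τ, x)[ω(τ, x)]`, `ω = curl U`, is
interval integrable on `[s, t]` for `s ≤ t < 0`: it is bounded, and measurable because `Δω`, `Dω`,
`DU`, `ω` are continuous in `τ` (Lipschitz clauses `k = 1, 2, 3`) while `U(τ, x) + b(τ)` is
measurable — the hypothesis `hint` of `integral_scalarEq_of_vorticityEq`
(`AxisymNoSwirlScalarEq`). [folklore] -/
theorem intervalIntegrable_vorticity_integrand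
    {U : ℝ → EuclideanSpace ℝ (Fin 3) → EuclideanSpace ℝ (Fin 3)} {b : ℝ → EuclideanSpace ℝ (Fin 3)}
    (hU : ∀ t < 0, ContDiff ℝ 4 (U t)) (hUm : Measurable (uncurry U)) (hbm : Measurable b)
    (hbC : ∃ C : ℝ, ∀ t, ‖b t‖ ≤ C)
    (hbd : ∀ k : ℕ, ∃ C : ℝ, ∀ t < 0, ∀ x, ‖iteratedFDeriv ℝ k (U t) x‖ ≤ C)
    (hlip : ∀ k : ℕ, 1 ≤ k → ∃ L : ℝ, ∀ s < 0, ∀ t < 0, ∀ x,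
      ‖iteratedFDeriv ℝ k (U t) x - iteratedFDeriv ℝ k (U s) x‖ ≤ L * |t - s|)
    (x : EuclideanSpace ℝ (Fin 3)) {s t : ℝ} (hst : s ≤ t) (ht : t < 0) :
    IntervalIntegrable (fun τ => (Δ (curl (U τ))) x - fderiv ℝ (curl (U τ)) x (U τ x + b τ) +
      fderiv ℝ (U τ) x (curl (U τ) x)) volume s t := by
  set K := ‖(curlCLM : (EuclideanSpace ℝ (Fin 3) →L[ℝ] EuclideanSpace ℝ (Fin 3)) →L[ℝ]
    EuclideanSpace ℝ (Fin 3))‖ with hK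
  have hU1 : ∀ τ < 0, ContDiff ℝ 1 (U τ) := fun τ hτ => (hU τ hτ).of_le (by norm_num)
  have hU2 : ∀ τ < 0, ContDiff ℝ 2 (U τ) := fun τ hτ => (hU τ hτ).of_le (by norm_num)
  have hU3 : ∀ τ < 0, ContDiff ℝ 3 (U τ) := fun τ hτ => (hU τ hτ).of_le (by norm_num)
  obtain ⟨L1, hL1⟩ := hlip 1 le_rfl
  obtain ⟨L2, hL2⟩ := hlip 2 (by norm_num)
  obtain ⟨L3, hL3⟩ := hlip 3 (by norm_num)
  have hsub : Ioc s t ⊆ Iio 0 := fun τ hτ => lt_of_le_of_lt hτ.2 ht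
  -- continuity in time of the smooth ingredients
  have hA : ContinuousOn (fun τ => (Δ (curl (U τ))) x) (Ioc s t) :=
    (continuousOn_laplacian_curl_slice hU3 hL3 x).mono hsub
  have hB : ContinuousOn (fun τ => fderiv ℝ (curl (U τ)) x) (Ioc s t) :=
    (continuousOn_fderiv_curl_slice hU2 hL2 x).mono hsub
  have hC : ContinuousOn (fun τ => fderiv ℝ (U τ) x) (Ioc s t) :=
    (continuousOn_fderiv_slice hU1 hL1 x).mono hsub
  have hD : ContinuousOn (fun τ => curl (U τ) x) (Ioc s t) :=
    (continuousOn_curl_slice hU1 hL1 x).mono hsub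
  -- measurability of the drift
  have hv : Measurable fun τ => U τ x + b τ :=
    (hUm.comp (measurable_id.prodMk measurable_const)).add hbm
  -- measurability of the integrand on `(s, t]`
  have happly : Continuous fun p : (EuclideanSpace ℝ (Fin 3) →L[ℝ] EuclideanSpace ℝ (Fin 3)) ×
      EuclideanSpace ℝ (Fin 3) => p.1 p.2 := isBoundedBilinearMap_apply.continuous
  have hmA : AEStronglyMeasurable (fun τ => (Δ (curl (U τ))) x) (volume.restrict (Ioc s t)) :=
    hA.aestronglyMeasurable measurableSet_Ioc
  have hmB : AEStronglyMeasurable (fun τ => fderiv ℝ (curl (U τ)) x (U τ x + b τ))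
      (volume.restrict (Ioc s t)) :=
    happly.comp_aestronglyMeasurable
      ((hB.aestronglyMeasurable measurableSet_Ioc).prodMk hv.aestronglyMeasurable)
  have hmC : AEStronglyMeasurable (fun τ => fderiv ℝ (U τ) x (curl (U τ) x))
      (volume.restrict (Ioc s t)) :=
    happly.comp_aestronglyMeasurable
      ((hC.aestronglyMeasurable measurableSet_Ioc).prodMk (hD.aestronglyMeasurable measurableSet_Ioc))
  -- bounds
  obtain ⟨Cb, hCb⟩ := hbC
  obtain ⟨C0, hC0⟩ := hbd 0
  obtain ⟨C1, hC1⟩ := hbd 1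
  obtain ⟨C2, hC2⟩ := hbd 2
  obtain ⟨C3, hC3⟩ := hbd 3
  have hbound : ∀ τ < 0, ‖(Δ (curl (U τ))) x - fderiv ℝ (curl (U τ)) x (U τ x + b τ) +
      fderiv ℝ (U τ) x (curl (U τ) x)‖ ≤ 3 * (K * C3) + K * C2 * (C0 + Cb) + C1 * (K * C1) := by
    intro τ hτ
    have h0 : ‖U τ x‖ ≤ C0 := by simpa using hC0 τ hτ x
    have h1 : ‖fderiv ℝ (U τ) x‖ ≤ C1 := by rw [← norm_iteratedFDeriv_one]; exact hC1 τ hτ x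
    have hω : ‖curl (U τ) x‖ ≤ K * C1 := by
      have h := norm_iteratedFDeriv_curl_le (n := 0) (hU1 τ hτ) x
      rw [norm_iteratedFDeriv_zero] at h
      exact h.trans (mul_le_mul_of_nonneg_left (hC1 τ hτ x) (by positivity))
    have hDω : ‖fderiv ℝ (curl (U τ)) x‖ ≤ K * C2 := by
      have h := norm_iteratedFDeriv_curl_le (n := 1) (hU2 τ hτ) x
      rw [norm_iteratedFDeriv_one] at h
      exact h.trans (mul_le_mul_of_nonneg_left (hC2 τ hτ x) (by positivity))
    have hΔω : ‖(Δ (curl (U τ))) x‖ ≤ 3 * (K * C3) :=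
      (norm_laplacian_le_three_mul _ x).trans (mul_le_mul_of_nonneg_left
        ((norm_iteratedFDeriv_curl_le (n := 2) (hU3 τ hτ) x).trans
          (mul_le_mul_of_nonneg_left (hC3 τ hτ x) (by positivity))) (by norm_num))
    have hKC1 : 0 ≤ K * C1 := (norm_nonneg _).trans hω
    have hC1' : 0 ≤ C1 := (norm_nonneg _).trans h1
    have hKC2 : 0 ≤ K * C2 := (norm_nonneg _).trans hDω
    set A : EuclideanSpace ℝ (Fin 3) := (Δ (curl (U τ))) x with hA'
    set B : EuclideanSpace ℝ (Fin 3) := fderiv ℝ (curl (U τ)) x (U τ x + b τ) with hB'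
    set D : EuclideanSpace ℝ (Fin 3) := fderiv ℝ (U τ) x (curl (U τ) x) with hD'
    have hBle : ‖B‖ ≤ K * C2 * (C0 + Cb) := by
      calc ‖B‖ ≤ ‖fderiv ℝ (curl (U τ)) x‖ * ‖U τ x + b τ‖ := ContinuousLinearMap.le_opNorm _ _
        _ ≤ K * C2 * (C0 + Cb) :=
            mul_le_mul hDω ((norm_add_le _ _).trans (add_le_add h0 (hCb τ))) (norm_nonneg _) hKC2
    have hDle : ‖D‖ ≤ C1 * (K * C1) := by
      calc ‖D‖ ≤ ‖fderiv ℝ (U τ) x‖ * ‖curl (U τ) x‖ := ContinuousLinearMap.le_opNorm _ _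
        _ ≤ C1 * (K * C1) := mul_le_mul h1 hω (norm_nonneg _) hC1'
    calc ‖A - B + D‖ ≤ ‖A - B‖ + ‖D‖ := norm_add_le _ _
      _ ≤ ‖A‖ + ‖B‖ + ‖D‖ := by linarith [norm_sub_le A B]
      _ ≤ 3 * (K * C3) + K * C2 * (C0 + Cb) + C1 * (K * C1) :=
          add_le_add (add_le_add hΔω hBle) hDle
  -- conclude
  rw [intervalIntegrable_iff_integrableOn_Ioc_of_le hst]
  refine IntegrableOn.of_bound measure_Ioc_lt_top ((hmA.sub hmB).add hmC)
    (3 * (K * C3) + K * C2 * (C0 + Cb) + C1 * (K * C1)) ?_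
  filter_upwards [ae_restrict_mem measurableSet_Ioc] with τ hτ
  exact hbound τ (hsub hτ)

end Literature.Analysis.FluidPDE

end
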